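import Literature.Computability.Complexity.MonotoneFormulaBalancing
import Literature.Computability.Complexity.MonotoneCliqueKWDepth
import Literature.Computability.Complexity.MonotonePerfectMatchingDepth
import HarnessLib

/-!
# From monotone depth to monotone formula size: `L_+(f) ≥ 2^{d_+(f)/c_b} − 1`; exponential monotone
# formula size for CLIQUE and PERFECT MATCHING (Raz–Wigderson) — PROVED

R. Raz, A. Wigderson, *Monotone circuits for matching require linear depth*, J. ACM 39 (1992),
abstract/§1 (p. 3: «we prove … the monotone formula size of perfect matching is `2^{Ω(n)}`»; the
translation depth ↔ formula size is Karchmer–Wigderson + formula balancing, `d_+(f) = Θ(log L_+(f))`);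
S. Jukna, *Boolean Function Complexity* (2012), Lemma 6.1 (Formula Balancing) and Cor. 7.27 («Every
monotone formula for `MATCH_n` must have size `2^{Ω(n)}`»).

* `two_rpow_le_formulaSizeOver_monotone` — the generic step: if `f` is monotone with
  `f(1⋯1) = 1`, `f(0⋯0) = 0` (so it HAS monotone formulas: the scan protocol, `KWTree.scanTree`) and
  every monotone circuit for `f` has depth `≥ D`, then `2^{D / c_b} ≤ L_+(f) + 1`, `c_b` the constant
  of `monotoneFormula_balancing_holds`.
* `RWClique.clique_monotoneFormulaSize` — ★ `2^{c s} ≤ L_+(CLIQUE(N, s))` for `s₀ ≤ s ≤ N/2`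
  (from `RWClique.clique_monotoneDepth_general`, RW Cor. 4.1).
* `RWPerfectMatching.pm_monotoneFormulaSize` — ★ `2^{c n} ≤ L_+(PM_{2n})` for `n ≥ n₀`
  (from `RWPerfectMatching.pm_monotoneDepth`, RW Thm. 4.1); the bipartite case is
  `RazWigderson1992_bpm_monotoneFormulaSize_holds`.

0 named facts.
-/

noncomputable section

namespace Literature.Computability.Complexity

open Finset Literature.Barriers.PneNP

/-- **Depth lower bounds give formula-size lower bounds** (Karchmer–Wigderson + balancing): for a
monotone `f` on a finite coordinate set with `f(1⋯1) = 1`, `f(0⋯0) = 0`, if every monotone circuit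
computing `f` has depth `≥ D` then `2^{D/c_b} ≤ L_+(f) + 1`, where `c_b` is any balancing constant
(every monotone formula `F` is equivalent to one of depth `≤ c_b log₂(|F|+1)`).
[cite: Jukna2012, Lemma 6.1 and §6.1 (D(f) = Θ(log L(f)))] [cite: RazWigderson1990, §1 (p. 3)] -/
theorem two_rpow_le_formulaSizeOver_monotone {ι : Type} [Fintype ι] (i₀ : ι)
    (f : (ι → Bool) → Bool) (hmono : Monotone f) (h1 : f (fun _ => true) = true)
    (h0 : f (fun _ => false) = false) {cb : ℝ} (hcb : 0 < cb)
    (Hb : ∀ F : Circuit ι, F.IsOver monotoneBasis → F.IsFormula →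
      ∃ F' : Circuit ι, F'.IsOver monotoneBasis ∧ F'.IsFormula ∧ (∀ x, F'.eval x = F.eval x) ∧
        (F'.depth : ℝ) ≤ cb * Real.logb 2 (F.size + 1))
    {D : ℝ} (hD : ∀ C : Circuit ι, C.IsOver monotoneBasis → C.Computes f → D ≤ (C.depth : ℝ)) :
    (2 : ℝ) ^ (D / cb) ≤ (formulaSizeOver monotoneBasis f : ℝ) + 1 := by
  classical
  set S : Set ℕ := {s | ∃ C : Circuit ι, C.IsOver monotoneBasis ∧ C.IsFormula ∧
    C.Computes f ∧ C.size = s} with hS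
  have hne : S.Nonempty := by
    obtain ⟨C, hO, hF, hC, -⟩ := (KWTree.scanTree i₀ Finset.univ.toList).exists_formula_of_solvesMono
      (KWTree.scanTree_solvesMono _ _ hmono) ⟨_, h1⟩ ⟨_, h0⟩
    exact ⟨C.size, C, hO, hF, hC, rfl⟩
  have hmem : formulaSizeOver monotoneBasis f ∈ S := by
    unfold formulaSizeOver
    exact Nat.sInf_mem hne
  obtain ⟨F, hO, hF, hC, hsize⟩ := hmem
  obtain ⟨F', hO', hF', heval, hdepth⟩ := Hb F hO hF
  have hC' : F'.Computes f := fun x => (heval x).trans (hC x)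
  have hd := hD F' hO' hC'
  have hlog : D / cb ≤ Real.logb 2 (F.size + 1) := by
    rw [div_le_iff₀ hcb]
    linarith [mul_comm cb (Real.logb 2 (F.size + 1))]
  have hpow := Real.rpow_le_rpow_of_exponent_le one_le_two hlog
  rw [Real.rpow_logb two_pos (by norm_num) (by positivity)] at hpow
  rw [← hsize]
  exact hpow

/-- From `2^{d·k/c_b} ≤ L + 1` to `2^{(d/(2c_b))·k} ≤ L` once `d·k ≥ 2 c_b`. [folklore] -/
private theorem rpow_half_le_of_sq_le {d cb k L : ℝ} (hd : 0 < d) (hcb : 0 < cb)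
    (hk : 2 * cb / d ≤ k) (h : (2 : ℝ) ^ (d * k / cb) ≤ L + 1) :
    (2 : ℝ) ^ (d / (2 * cb) * k) ≤ L := by
  set A : ℝ := (2 : ℝ) ^ (d / (2 * cb) * k) with hA
  have hA2 : A * A = (2 : ℝ) ^ (d * k / cb) := by
    rw [hA, ← Real.rpow_add two_pos]
    congr 1
    field_simp
    ring
  have hcm : 1 ≤ d / (2 * cb) * k := by
    rw [div_le_iff₀ hd] at hk
    rw [div_mul_eq_mul_div, le_div_iff₀ (by positivity)]
    linarith
  have hA1 : 2 ≤ A := by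
    have := Real.rpow_le_rpow_of_exponent_le one_le_two hcm
    rwa [Real.rpow_one] at this
  nlinarith [hA2, h, hA1]

namespace RWClique

/-- The all-ones graph has `s`-cliques for `s ≤ N`. [folklore] -/
private theorem cliqueFn_true {N s : ℕ} (hs : s ≤ N) : cliqueFn N s (fun _ => true) = true := by
  classical
  rw [cliqueFn_eq_true_iff]
  intro hfree
  obtain ⟨S, -, hS⟩ := Finset.exists_subset_card_eq (s := (Finset.univ : Finset (Fin N)))
    (by simpa using hs)
  refine hfree S ⟨fun u _ v _ huv => ?_, hS⟩
  rw [cliqueGraph_adj]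
  exact ⟨huv, rfl⟩

/-- The empty graph has no `s`-clique for `s ≥ 2`. [folklore] -/
private theorem cliqueFn_false {N s : ℕ} (hs : 2 ≤ s) : cliqueFn N s (fun _ => false) = false := by
  classical
  rw [cliqueFn_eq_false_iff]
  intro S hS
  rw [SimpleGraph.isNClique_iff] at hS
  obtain ⟨hcl, hcard⟩ := hS
  obtain ⟨T, hT, hT2⟩ := Finset.exists_subset_card_eq (s := S) (n := 2) (by omega)
  obtain ⟨u, v, huv, rfl⟩ := Finset.card_eq_two.1 hT2
  have h := hcl (hT (by simp)) (hT (by simp)) huv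
  rw [cliqueGraph_adj] at h
  obtain ⟨-, h⟩ := h
  exact Bool.false_ne_true h

/-- ★ **Raz–Wigderson: monotone formulas for `CLIQUE(N, s)`, `s ≤ N/2`, have size `2^{Ω(s)}`.**
There are `c > 0`, `s₀` such that `2^{c·s} ≤ formulaSizeOver monotoneBasis (cliqueFn N s)` whenever
`s₀ ≤ s` and `2s ≤ N` (depth `Ω(s)` by Cor. 4.1, then Karchmer–Wigderson and formula balancing).
[cite: RazWigderson1990, Cor. 4.1 (p. 14) and §1 (p. 3)] [cite: Jukna2012, Lemma 6.1] -/
theorem clique_monotoneFormulaSize :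
    ∃ c : ℝ, 0 < c ∧ ∃ s₀ : ℕ, ∀ (N s : ℕ), s₀ ≤ s → 2 * s ≤ N →
      (2 : ℝ) ^ (c * s) ≤ (formulaSizeOver monotoneBasis (cliqueFn N s) : ℝ) := by
  classical
  obtain ⟨cd, hcd, s₁, Hd⟩ := clique_monotoneDepth_general
  obtain ⟨cb, hcb, Hb⟩ := monotoneFormula_balancing_holds
  refine ⟨cd / (2 * cb), by positivity, max s₁ (max 2 ⌈2 * cb / cd⌉₊), fun N s hs hN => ?_⟩
  have hs₁ : s₁ ≤ s := le_trans (le_max_left _ _) hs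
  have hs2 : 2 ≤ s := le_trans (le_trans (le_max_left _ _) (le_max_right _ _)) hs
  have hsM : ⌈2 * cb / cd⌉₊ ≤ s := le_trans (le_trans (le_max_right _ _) (le_max_right _ _)) hs
  have hN0 : 0 < N := by omega
  have hN1 : 1 < N := by omega
  have key := two_rpow_le_formulaSizeOver_monotone
    (⟨s((⟨0, hN0⟩ : Fin N), ⟨1, hN1⟩), by simp⟩ : Edge N) (cliqueFn N s) (cliqueFn_monotone_holds N s)
    (cliqueFn_true (by omega)) (cliqueFn_false hs2) hcb (Hb (Edge N)) (D := cd * s)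
    (fun C hO hC => Hd N s hs₁ hN C hO hC)
  refine rpow_half_le_of_sq_le hcd hcb ?_ key
  exact le_trans (Nat.le_ceil _) (by exact_mod_cast hsM)

end RWClique

namespace RWPerfectMatching

/-- `K_{2n}` has a perfect matching; the empty graph on `2n ≥ 2` vertices has none. [folklore] -/
private theorem pmFn_true_false {n : ℕ} (hn : 0 < n) :
    pmFn (n + n) (fun _ => true) = true ∧ pmFn (n + n) (fun _ => false) = false := by
  constructor
  · have h := pmFn_extendAlong (n := n) (fun _ => true)
    rw [show perfectMatchingFn n (fun _ => true) = true from
      (perfectMatchingFn_eq_true_iff n _).2 ⟨Equiv.refl _, fun _ => rfl⟩] at h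
    have hle : KWTree.extendAlong embB (fun _ : Fin n × Fin n => true) ≤ fun _ => true :=
      fun _ => Bool.le_true _
    have := pmFn_monotone (n + n) hle
    rw [h] at this
    exact Bool.eq_true_of_true_le this
  · rw [Bool.eq_false_iff]
    intro h
    obtain ⟨σ, hfix, -, hedge⟩ := (pmFn_eq_true_iff _).1 h
    exact Bool.false_ne_true (hedge ⟨0, by omega⟩)

/-- ★ **Raz–Wigderson: monotone formulas for PERFECT MATCHING have size `2^{Ω(n)}`** («the monotone
formula size of perfect matching is `2^{Ω(n)}`»): there are `c > 0`, `n₀` with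
`2^{c·n} ≤ formulaSizeOver monotoneBasis (pmFn (n+n))` for `n ≥ n₀`.
[cite: RazWigderson1990, §1 (p. 3) and Thm. 4.1 (p. 13)] [cite: Jukna2012, Lemma 6.1 and Cor. 7.27] -/
theorem pm_monotoneFormulaSize :
    ∃ c : ℝ, 0 < c ∧ ∃ n₀ : ℕ, ∀ n ≥ n₀,
      (2 : ℝ) ^ (c * n) ≤ (formulaSizeOver monotoneBasis (pmFn (n + n)) : ℝ) := by
  classical
  obtain ⟨cd, hcd, n₁, Hd⟩ := pm_monotoneDepth
  obtain ⟨cb, hcb, Hb⟩ := monotoneFormula_balancing_holds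
  refine ⟨cd / (2 * cb), by positivity, max n₁ (max 1 ⌈2 * cb / cd⌉₊), fun n hn => ?_⟩
  have hn₁ : n₁ ≤ n := le_trans (le_max_left _ _) hn
  have hn1 : 1 ≤ n := le_trans (le_trans (le_max_left _ _) (le_max_right _ _)) hn
  have hnM : ⌈2 * cb / cd⌉₊ ≤ n := le_trans (le_trans (le_max_right _ _) (le_max_right _ _)) hn
  obtain ⟨h1, h0⟩ := pmFn_true_false (n := n) hn1
  have key := two_rpow_le_formulaSizeOver_monotone (embB (⟨0, hn1⟩, ⟨0, hn1⟩)) (pmFn (n + n))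
    (pmFn_monotone (n + n)) h1 h0 hcb (Hb (RWClique.Edge (n + n))) (D := cd * n)
    (fun C hO hC => Hd n hn₁ C hO hC)
  refine rpow_half_le_of_sq_le hcd hcb ?_ key
  exact le_trans (Nat.le_ceil _) (by exact_mod_cast hnM)

end RWPerfectMatching

end Literature.Computability.Complexity

end
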